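import Literature.RepresentationTheory.KonnoKonno2007.JunctionVacuumSectionLevi
import Literature.RepresentationTheory.KonnoKonno2007.JunctionSwapSymmetry
import HarnessLib

/-!
# `KAK` implementer data for the junction when the SECOND factor has real rank one

The `V ↔ W` symmetry of the dual pair `U(V) × U(W) ↪ Sp(V ⊗ W)` is in the tree
(`JunctionSwapSymmetry`: the block relabelling `swapIdx : DPIdx P Q R S ≃ DPIdx R S P Q` and
`RealDualPair.ι𝕎_swap_apply` — the archimedean symplectic action of `(g_V, g_W)` on `ℝ^{DPIdx P Q R S}` is that
of `(g_W, g_V)` on `ℝ^{DPIdx R S P Q}` conjugated by the relabelling).  This file makes the symmetry usable at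
the level of PHASE MAPS, unitary FRAMES and Levi DILATIONS — the three inputs of the Levi-family constructor
`kakImplementerData_leviFamily` (`JunctionVacuumSectionLevi`) — and derives the `KAK` implementer data of
`U(P,Q) × U(R,S)` along the hyperbolic torus of the SECOND factor: the one-parameter group `(1, a'_t)`,
`a'_t = hypV r₀ s₀ t ∈ U(R,S)`, acts on phase space by the Levi map `realify u⁻¹ ∘ m(δ_t, δ_t⁻¹) ∘ realify u`
in the reindexed frame `u = frameW`, `δ_t = planeDilW t` (`ι𝕎_one_hypV_eq_conj_leviPhase`, transported from
`JunctionHyperbolicFamily.hypPhase_eq` of the swapped pair), whence `kakImplementerData_junction_swap` when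
`|S| = 1` and `U(P) × U(Q) → U(P,Q)` is onto (the first factor compact, e.g. `Q` or `P` empty).  This is the
shape of the archimedean pair at a real place where the Hermitian space `V` is definite and the
`2`-dimensional `W` has signature `(1,1)`; together with `JunctionVacuumSection` (first factor of rank one,
second compact) it covers every real place at which at most one of `V`, `W` is indefinite of rank one.

Contents:
* §1 (generic, index types `σ`, `σ'`, `ε : σ ≃ σ'`): `reindexPhase ε`, `reindexUnitary ε` (a monoid hom
  `U(σ') →* U(σ)`, `U ↦ (U_{ε i, ε j})`), `reindexLin ε`; `reindexPhase_comp`, `reindexPhase_realify`,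
  `reindexPhase_leviPhase`, `reindexPhase_conj_leviPhase`, `reindexLin_dotProduct`, `continuous_reindexLin_symm`.
* §2 `ι𝕎_swap` (the tree's `ι𝕎_swap_apply` as a `reindexPhase` identity), `frameW`, `planeDilW`,
  `ι𝕎_one_hypV_eq_conj_leviPhase`, `kakWordW_eq`, `dpkSwap`, `isProperMap_kakWordW`, `kakWordW_surjective`,
  `kakImplementerData_junction_swap` (+ `_of_isEmpty_right/left`).

All statements are kernel-proved; no cited statement enters as a hypothesis.

References: K. Konno, T. Konno, 2007, §3.1 (3.1) (the embedding `ι_{V,W}`); C. Mœglin, M.-F. Vignéras,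
J.-L. Waldspurger, Correspondances de Howe sur un corps p-adique, LNM 1291 (1987), Ch. 1 I.17 (dual pairs are
symmetric in the two factors); G. B. Folland, Harmonic Analysis in Phase Space, 1989, §4.2 (4.24), Prop. (4.39);
A. W. Knapp, Lie Groups Beyond an Introduction, 2002, Thm 7.39 (`KAK`).
-/

noncomputable section

open MeasureTheory Complex SchwartzMap Matrix
open scoped InnerProductSpace ComplexConjugate Real Kronecker

namespace Literature.RepresentationTheory.KonnoKonno2007

open Literature.Analysis.SegalBargmann Literature.RepresentationTheory.HeisenbergGroup
open Literature.NumberTheory.Weil1964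

local notation "SR" σ => SchwartzMap (σ → ℝ) ℂ
local notation "PV" σ => (σ → ℝ) × (σ → ℝ)

/-! ## 1. Reindexing phase maps, unitary frames and dilations along an index bijection -/

section Reindex

variable {σ σ' : Type*} [Fintype σ] [DecidableEq σ] [Fintype σ'] [DecidableEq σ']

/-- **Reindexing a phase map** along `ε : σ ≃ σ'`: `φ^ε (p, q) := (φ (p ∘ ε⁻¹, q ∘ ε⁻¹)) ∘ ε` componentwise.
[folklore] -/
def reindexPhase (ε : σ ≃ σ') (φ : PhaseMap σ') : PhaseMap σ := fun pq =>
  ((φ (pq.1 ∘ ε.symm, pq.2 ∘ ε.symm)).1 ∘ ε, (φ (pq.1 ∘ ε.symm, pq.2 ∘ ε.symm)).2 ∘ ε)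

omit [Fintype σ] [DecidableEq σ] [Fintype σ'] [DecidableEq σ'] in
/-- unfolding `reindexPhase`. [folklore] -/
theorem reindexPhase_apply (ε : σ ≃ σ') (φ : PhaseMap σ') (pq : PV σ) :
    reindexPhase ε φ pq =
      ((φ (pq.1 ∘ ε.symm, pq.2 ∘ ε.symm)).1 ∘ ε, (φ (pq.1 ∘ ε.symm, pq.2 ∘ ε.symm)).2 ∘ ε) := rfl

omit [Fintype σ] [DecidableEq σ] [Fintype σ'] [DecidableEq σ'] in
/-- Reindexing is multiplicative: `(φ ∘ ψ)^ε = φ^ε ∘ ψ^ε`. [folklore] -/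
theorem reindexPhase_comp (ε : σ ≃ σ') (φ ψ : PhaseMap σ') :
    reindexPhase ε (φ ∘ ψ) = reindexPhase ε φ ∘ reindexPhase ε ψ := by
  funext pq
  simp only [reindexPhase_apply, Function.comp_apply, Function.comp_assoc, Equiv.self_comp_symm,
    Function.comp_id, Prod.mk.eta]

omit [Fintype σ] [DecidableEq σ] [Fintype σ'] [DecidableEq σ'] in
/-- pointwise form of `reindexPhase_comp`. [folklore] -/
theorem reindexPhase_comp_apply (ε : σ ≃ σ') (φ ψ : PhaseMap σ') (pq : PV σ) :
    reindexPhase ε (fun w => φ (ψ w)) pq = reindexPhase ε φ (reindexPhase ε ψ pq) :=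
  congrFun (reindexPhase_comp ε φ ψ) pq

/-- the reindexed matrix `(M_{ε i, ε j})_{i j}` of a unitary matrix is unitary. [folklore] -/
theorem submatrix_mem_unitaryGroup (ε : σ ≃ σ') (U : Matrix.unitaryGroup σ' ℂ) :
    (U : Matrix σ' σ' ℂ).submatrix ε ε ∈ Matrix.unitaryGroup σ ℂ := by
  rw [Matrix.mem_unitaryGroup_iff, Matrix.star_eq_conjTranspose, Matrix.conjTranspose_submatrix,
    Matrix.submatrix_mul_equiv, ← Matrix.star_eq_conjTranspose, Matrix.mem_unitaryGroup_iff.1 U.2,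
    Matrix.submatrix_one_equiv]

/-- **Reindexing a unitary frame**: `U(σ') →* U(σ)`, `U ↦ (U_{ε i, ε j})_{i, j}`. [folklore] -/
def reindexUnitary (ε : σ ≃ σ') : Matrix.unitaryGroup σ' ℂ →* Matrix.unitaryGroup σ ℂ where
  toFun U := ⟨(U : Matrix σ' σ' ℂ).submatrix ε ε, submatrix_mem_unitaryGroup ε U⟩
  map_one' := Subtype.ext (Matrix.submatrix_one_equiv ε)
  map_mul' U U' := Subtype.ext (by
    show ((U * U' : Matrix.unitaryGroup σ' ℂ) : Matrix σ' σ' ℂ).submatrix ε ε =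
      (U : Matrix σ' σ' ℂ).submatrix ε ε * (U' : Matrix σ' σ' ℂ).submatrix ε ε
    rw [Matrix.submatrix_mul_equiv]
    rfl)

/-- entries of the reindexed frame. [folklore] -/
@[simp] theorem reindexUnitary_apply (ε : σ ≃ σ') (U : Matrix.unitaryGroup σ' ℂ) (i j : σ) :
    ((reindexUnitary ε U : Matrix.unitaryGroup σ ℂ) : Matrix σ σ ℂ) i j = (U : Matrix σ' σ' ℂ) (ε i) (ε j) := rfl

omit [Fintype σ] [DecidableEq σ] [Fintype σ'] [DecidableEq σ'] in
/-- `phasePt` commutes with reindexing. [folklore] -/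
theorem phasePt_comp_equiv (e : σ' → σ) (p q : σ → ℝ) : phasePt (p ∘ e) (q ∘ e) = phasePt p q ∘ e := rfl

/-- **Reindexing the realification of a unitary frame**: `(realify U)^ε = realify U^ε`. [folklore] -/
theorem reindexPhase_realify (ε : σ ≃ σ') (U : Matrix.unitaryGroup σ' ℂ) :
    reindexPhase ε (realify U) = realify (reindexUnitary ε U) := by
  funext pq
  have h : ∀ i, ((U : Matrix σ' σ' ℂ) *ᵥ phasePt (pq.1 ∘ ε.symm) (pq.2 ∘ ε.symm)) (ε i) =
      (((reindexUnitary ε U : Matrix.unitaryGroup σ ℂ) : Matrix σ σ ℂ) *ᵥ phasePt pq.1 pq.2) i := fun i => by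
    rw [phasePt_comp_equiv]
    exact (congrFun (submatrix_mulVec_equiv (U : Matrix σ' σ' ℂ) (phasePt pq.1 pq.2) ε ε) i).symm
  refine Prod.ext (funext fun i => ?_) (funext fun i => ?_)
  · show (((U : Matrix σ' σ' ℂ) *ᵥ phasePt (pq.1 ∘ ε.symm) (pq.2 ∘ ε.symm)) (ε i)).re = _
    rw [h i]
    rfl
  · show (((U : Matrix σ' σ' ℂ) *ᵥ phasePt (pq.1 ∘ ε.symm) (pq.2 ∘ ε.symm)) (ε i)).im = _
    rw [h i]
    rfl

/-- **Reindexing a linear change of coordinates**: `L^ε x := (L (x ∘ ε⁻¹)) ∘ ε`. [folklore] -/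
def reindexLin (ε : σ ≃ σ') (L : (σ' → ℝ) ≃ₗ[ℝ] (σ' → ℝ)) : (σ → ℝ) ≃ₗ[ℝ] (σ → ℝ) :=
  ((LinearEquiv.funCongrLeft ℝ ℝ ε).symm.trans L).trans (LinearEquiv.funCongrLeft ℝ ℝ ε)

omit [Fintype σ] [DecidableEq σ] [Fintype σ'] [DecidableEq σ'] in
/-- unfolding `reindexLin`. [folklore] -/
@[simp] theorem reindexLin_apply (ε : σ ≃ σ') (L : (σ' → ℝ) ≃ₗ[ℝ] (σ' → ℝ)) (x : σ → ℝ) :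
    reindexLin ε L x = L (x ∘ ε.symm) ∘ ε := rfl

omit [Fintype σ] [DecidableEq σ] [Fintype σ'] [DecidableEq σ'] in
/-- `(L^ε)⁻¹ = (L⁻¹)^ε`. [folklore] -/
theorem reindexLin_symm (ε : σ ≃ σ') (L : (σ' → ℝ) ≃ₗ[ℝ] (σ' → ℝ)) :
    (reindexLin ε L).symm = reindexLin ε L.symm :=
  LinearEquiv.ext fun _ => rfl

omit [Fintype σ] [DecidableEq σ] [Fintype σ'] [DecidableEq σ'] in
/-- **Reindexing a Levi phase map**: `m(L, Ld)^ε = m(L^ε, Ld^ε)`. [folklore] -/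
theorem reindexPhase_leviPhase (ε : σ ≃ σ') (L Ld : (σ' → ℝ) ≃ₗ[ℝ] (σ' → ℝ)) :
    reindexPhase ε (leviPhase L Ld) = leviPhase (reindexLin ε L) (reindexLin ε Ld) := rfl

/-- **Reindexing a Levi map in a unitary frame**:
`(realify U⁻¹ ∘ m(L, Ld) ∘ realify U)^ε = realify (U^ε)⁻¹ ∘ m(L^ε, Ld^ε) ∘ realify U^ε`. [folklore] -/
theorem reindexPhase_conj_leviPhase (ε : σ ≃ σ') (U : Matrix.unitaryGroup σ' ℂ) (L Ld : (σ' → ℝ) ≃ₗ[ℝ] (σ' → ℝ)) :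
    reindexPhase ε (fun w => realify U⁻¹ (leviPhase L Ld (realify U w))) = fun pq =>
      realify (reindexUnitary ε U)⁻¹
        (leviPhase (reindexLin ε L) (reindexLin ε Ld) (realify (reindexUnitary ε U) pq)) := by
  have h : (fun w => realify U⁻¹ (leviPhase L Ld (realify U w))) = realify U⁻¹ ∘ leviPhase L Ld ∘ realify U := rfl
  rw [h, reindexPhase_comp, reindexPhase_comp, reindexPhase_realify, reindexPhase_realify, reindexPhase_leviPhase,
    map_inv]
  rfl

omit [DecidableEq σ] [DecidableEq σ'] in
/-- **contragredience transfers**: if `L x · Ld y = x · y` then `L^ε x · Ld^ε y = x · y`. [folklore] -/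
theorem reindexLin_dotProduct (ε : σ ≃ σ') {L Ld : (σ' → ℝ) ≃ₗ[ℝ] (σ' → ℝ)}
    (had : ∀ x y : σ' → ℝ, L x ⬝ᵥ Ld y = x ⬝ᵥ y) (x y : σ → ℝ) :
    reindexLin ε L x ⬝ᵥ reindexLin ε Ld y = x ⬝ᵥ y := by
  rw [reindexLin_apply, reindexLin_apply, comp_equiv_dotProduct_comp_equiv, had, comp_equiv_dotProduct_comp_equiv]

omit [DecidableEq σ] [DecidableEq σ'] in
/-- the inverse of the reindexed dilation as a continuous linear map, factored through the fixed reindexing maps.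
[folklore] -/
theorem reindexLin_symm_toContinuousLinearMap (ε : σ ≃ σ') (L : (σ' → ℝ) ≃ₗ[ℝ] (σ' → ℝ)) :
    (((reindexLin ε L).symm.toContinuousLinearEquiv : (σ → ℝ) ≃L[ℝ] (σ → ℝ)) : (σ → ℝ) →L[ℝ] (σ → ℝ)) =
      (((LinearEquiv.funCongrLeft ℝ ℝ ε).toContinuousLinearEquiv : (σ' → ℝ) ≃L[ℝ] (σ → ℝ)) :
          (σ' → ℝ) →L[ℝ] (σ → ℝ)).comp
        ((((L.symm.toContinuousLinearEquiv : (σ' → ℝ) ≃L[ℝ] (σ' → ℝ)) : (σ' → ℝ) →L[ℝ] (σ' → ℝ))).comp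
          (((LinearEquiv.funCongrLeft ℝ ℝ ε).symm.toContinuousLinearEquiv : (σ → ℝ) ≃L[ℝ] (σ' → ℝ)) :
            (σ → ℝ) →L[ℝ] (σ' → ℝ))) :=
  ContinuousLinearMap.ext fun _ => rfl

omit [DecidableEq σ] [DecidableEq σ'] in
/-- **continuity of the reindexed dilation family** (in the operator norm of the inverses, the input of
`continuous_leviS_uncurry`). [folklore] -/
theorem continuous_reindexLin_symm {X : Type*} [TopologicalSpace X] (ε : σ ≃ σ')
    {L : X → ((σ' → ℝ) ≃ₗ[ℝ] (σ' → ℝ))}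
    (hL : Continuous fun x => (((L x).symm.toContinuousLinearEquiv : (σ' → ℝ) ≃L[ℝ] (σ' → ℝ)) :
      (σ' → ℝ) →L[ℝ] (σ' → ℝ))) :
    Continuous fun x => (((reindexLin ε (L x)).symm.toContinuousLinearEquiv : (σ → ℝ) ≃L[ℝ] (σ → ℝ)) :
      (σ → ℝ) →L[ℝ] (σ → ℝ)) := by
  simp only [reindexLin_symm_toContinuousLinearMap]
  exact continuous_const.clm_comp (hL.clm_comp continuous_const)

end Reindex

namespace RealDualPair

open Literature.NumberTheory.Automorphic Literature.NumberTheory.Automorphic.UnitaryGroup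

/-- **The `V ↔ W` symmetry of the dual pair, as a reindexing of phase maps**: the archimedean symplectic
action of `(g_V, g_W) ∈ U(P,Q) × U(R,S)` on the phase space of `ℝ^{DPIdx P Q R S}` is that of
`(g_W, g_V) ∈ U(R,S) × U(P,Q)` on `ℝ^{DPIdx R S P Q}` reindexed along `swapIdx` — the tree's `ι𝕎_swap_apply`
(`JunctionSwapSymmetry`) rewritten with `reindexPhase` and `swapIdx_symm`.
[cite: MoeglinVignerasWaldspurger1987, Ch. 1 I.17; KonnoKonno2007, §3.1 (3.1)] -/
theorem ι𝕎_swap {P Q R S : Type*} [Fintype P] [DecidableEq P] [Fintype Q] [DecidableEq Q] [Fintype R]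
    [DecidableEq R] [Fintype S] [DecidableEq S] (g : Ginf P Q R S) (pq : PV (DPIdx P Q R S)) :
    ((ι𝕎 P Q R S g).1 : (PV (DPIdx P Q R S)) ≃ₗ[ℝ] PV (DPIdx P Q R S)) pq =
      reindexPhase (swapIdx P Q R S)
        (⇑((ι𝕎 R S P Q (g.2, g.1)).1 : (PV (DPIdx R S P Q)) ≃ₗ[ℝ] PV (DPIdx R S P Q))) pq := by
  rw [reindexPhase_apply, ι𝕎_swap_apply, swapIdx_symm, swapIdx_symm]

/-! ## 2. The hyperbolic family of the SECOND factor and the `KAK` data for `|S| = 1` -/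

section SecondFactor

variable (P Q : Type*) {R S : Type*} [Fintype P] [DecidableEq P] [Fintype Q] [DecidableEq Q] [Fintype R]
  [DecidableEq R] [Fintype S] [DecidableEq S] (r₀ : R) (s₀ : S)

-- Notation (NOT a definition), as in `JunctionVacuumSection`: the archimedean symplectic action of `G_∞` on the
-- polarised phase space, as phase maps — `γ𝕎 g = ⇑(ι𝕎 P Q R S g)`.
set_option quotPrecheck false in
local notation "γ𝕎[" P ", " Q ", " R ", " S "]" =>
  fun g : Ginf P Q R S => (⇑((ι𝕎 P Q R S g).1 : (PV (DPIdx P Q R S)) ≃ₗ[ℝ] PV (DPIdx P Q R S)) :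
    PhaseMap (DPIdx P Q R S))

/-- **The unitary frame of the `W`-boost**: the frame `frameU P Q r₀ s₀` of the swapped pair (planes
`{e_{r₀} ⊗ e_i, e_{s₀} ⊗ e_i}`), reindexed to `DPIdx P Q R S`. [folklore] -/
def frameW : Matrix.unitaryGroup (DPIdx P Q R S) ℂ :=
  reindexUnitary (swapIdx P Q R S) (frameU P Q r₀ s₀ : Matrix.unitaryGroup (DPIdx R S P Q) ℂ)

/-- **The dilation of the `W`-boost in its frame**: `planeDil P Q r₀ s₀ eᵗ` of the swapped pair, reindexed.
[folklore] -/
def planeDilW (t : ℝ) : (DPIdx P Q R S → ℝ) ≃ₗ[ℝ] (DPIdx P Q R S → ℝ) :=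
  reindexLin (swapIdx P Q R S) (planeDil P Q r₀ s₀ (Real.exp t) (Real.exp_pos t).ne')

/-- **The phase map of `(1, a'_t)` is a Levi map in the frame `frameW`**:
`ι𝕎 (1, hypV r₀ s₀ t) = realify u⁻¹ ∘ m(δ_t, δ_t⁻¹) ∘ realify u`, `u = frameW`, `δ_t = planeDilW t` — the
`W`-side companion of `JunctionHyperbolicFamily.hypPhase_eq`, obtained from it by the `V ↔ W` symmetry.
[cite: Folland1989, (4.24), Prop. (4.39); KonnoKonno2007, §3.1] -/
theorem ι𝕎_one_hypV_eq_conj_leviPhase (t : ℝ) (pq : PV (DPIdx P Q R S)) :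
    ((ι𝕎 P Q R S ((1 : UForm P Q), (hypV r₀ s₀ t : UForm R S))).1 :
        (PV (DPIdx P Q R S)) ≃ₗ[ℝ] PV (DPIdx P Q R S)) pq =
      realify (frameW P Q r₀ s₀)⁻¹
        (leviPhase (planeDilW P Q r₀ s₀ t) (planeDilW P Q r₀ s₀ t).symm (realify (frameW P Q r₀ s₀) pq)) := by
  have h : (⇑((ι𝕎 R S P Q ((hypV r₀ s₀ t : UForm R S), (1 : UForm P Q))).1 :
      (PV (DPIdx R S P Q)) ≃ₗ[ℝ] PV (DPIdx R S P Q))) =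
      fun w => realify (frameU P Q r₀ s₀)⁻¹
        (leviPhase (planeDil P Q r₀ s₀ (Real.exp t) (Real.exp_pos t).ne')
          (planeDil P Q r₀ s₀ (Real.exp t) (Real.exp_pos t).ne').symm (realify (frameU P Q r₀ s₀) w)) :=
    funext fun w => (hypPhase_eq P Q r₀ s₀ t w).symm
  rw [ι𝕎_swap]
  dsimp only []
  rw [h, reindexPhase_conj_leviPhase, ← reindexLin_symm]
  rfl

/-- The `KAK` word map of the pair along the `W`-torus: `(k, t, k') ↦ κ k · (1, a'_t) · κ k'`. It is the swapped
pair's `kakMapPair r₀ s₀` conjugated by the coordinate exchanges. [folklore] -/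
theorem kakWordW_eq :
    (fun p : DPK P Q R S × ℝ × DPK P Q R S =>
        κ P Q R S p.1 * (((1 : UForm P Q), (hypV r₀ s₀ p.2.1 : UForm R S)) : Ginf P Q R S) * κ P Q R S p.2.2) =
      Prod.swap ∘ (kakMapPair (R := P) (S := Q) r₀ s₀) ∘
        fun p : DPK P Q R S × ℝ × DPK P Q R S => (p.1.swap, p.2.1, p.2.2.swap) := by
  funext ⟨k, t, k'⟩
  rfl

/-- the coordinate exchange `((k₁,k₂), t, (k₁',k₂')) ↦ ((k₂,k₁), t, (k₂',k₁'))` as a homeomorphism. [folklore] -/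
def dpkSwap : DPK P Q R S × ℝ × DPK P Q R S ≃ₜ DPK R S P Q × ℝ × DPK R S P Q :=
  (Homeomorph.prodComm _ _).prodCongr ((Homeomorph.refl ℝ).prodCongr (Homeomorph.prodComm _ _))

/-- unfolding `dpkSwap`. [folklore] -/
theorem dpkSwap_apply (p : DPK P Q R S × ℝ × DPK P Q R S) :
    dpkSwap P Q (R := R) (S := S) p = (p.1.swap, p.2.1, p.2.2.swap) := rfl

/-- **The word map along the `W`-torus is proper** (`|S| = 1`). [cite: Knapp2002, Thm 7.39] -/
theorem isProperMap_kakWordW [Subsingleton S] :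
    IsProperMap fun p : DPK P Q R S × ℝ × DPK P Q R S =>
      κ P Q R S p.1 * (((1 : UForm P Q), (hypV r₀ s₀ p.2.1 : UForm R S)) : Ginf P Q R S) * κ P Q R S p.2.2 := by
  rw [kakWordW_eq]
  exact ((Homeomorph.prodComm (UForm R S) (UForm P Q)).isProperMap.comp (isProperMap_kakMapPair r₀ s₀)).comp
    (dpkSwap P Q (R := R) (S := S)).isProperMap

/-- **The word map along the `W`-torus is onto** (`|S| = 1`, `U(P) × U(Q) → U(P,Q)` onto).
[cite: Knapp2002, Thm 7.39] -/
theorem kakWordW_surjective [Subsingleton S] (hV : Function.Surjective (UForm.kV P Q)) :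
    Function.Surjective fun p : DPK P Q R S × ℝ × DPK P Q R S =>
      κ P Q R S p.1 * (((1 : UForm P Q), (hypV r₀ s₀ p.2.1 : UForm R S)) : Ginf P Q R S) * κ P Q R S p.2.2 := by
  rw [kakWordW_eq]
  exact (Prod.swap_surjective.comp (kakMapPair_surjective r₀ s₀ hV)).comp
    (dpkSwap P Q (R := R) (S := S)).surjective

/-- **`KAK` implementer data of `U(P,Q) × U(R,S)` along the `W`-torus** (`|S| = 1`, first factor with
`U(P) × U(Q) → U(P,Q)` onto): compact part `μ₀ ∘ dualPairι`, `A`-part the Levi family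
`t ↦ μ₀(u)⁻¹ ∘ leviS (δ_t) ∘ μ₀(u)` in the frame `u = frameW`, `δ_t = planeDilW t`, over `a'_t = (1, hypV r₀ s₀ t)`.
[cite: Folland1989, §4.2 (4.24) p. 156, Prop. (4.39); Knapp2002, Thm 7.39; KonnoKonno2007, §3.1] -/
theorem kakImplementerData_junction_swap [Subsingleton S] (hV : Function.Surjective (UForm.kV P Q)) :
    KAKImplementerData (γ𝕎[P, Q, R, S]) (κ P Q R S)
      (fun t : ℝ => (((1 : UForm P Q), (hypV r₀ s₀ t : UForm R S)) : Ginf P Q R S))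
      (fun k : DPK P Q R S => unitaryOpPi (dualPairι k))
      (fun t : ℝ => (unitaryOpPi (frameW P Q r₀ s₀)⁻¹).comp
        ((leviS (planeDilW P Q r₀ s₀ t)).comp (unitaryOpPi (frameW P Q r₀ s₀)))) := by
  refine kakImplementerData_leviFamily (γ := γ𝕎[P, Q, R, S]) (κ := κ P Q R S)
    (a := fun t : ℝ => (((1 : UForm P Q), (hypV r₀ s₀ t : UForm R S)) : Ginf P Q R S))
    (symplecticPhaseMap_mul (ι𝕎 P Q R S)) dualPairι continuous_dualPairι (fun k pq => ι𝕎_κ_apply R S k pq)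
    (frameW P Q r₀ s₀) (L := planeDilW P Q r₀ s₀) (Ld := fun t => (planeDilW P Q r₀ s₀ t).symm) ?_
    (continuous_reindexLin_symm (swapIdx P Q R S) (continuous_planeDil_exp_symm P Q r₀ s₀))
    (ι𝕎_one_hypV_eq_conj_leviPhase P Q r₀ s₀) (isProperMap_kakWordW P Q r₀ s₀) (kakWordW_surjective P Q r₀ s₀ hV)
  intro t x y
  rw [planeDilW, reindexLin_symm]
  exact reindexLin_dotProduct (swapIdx P Q R S) (planeDil_dotProduct_symm P Q r₀ s₀ (Real.exp t) (Real.exp_pos t).ne')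
    x y

/-- The case `Q` empty (`V` positive definite at the place). [cite: Folland1989, Prop. (4.39); Knapp2002, Thm 7.39] -/
theorem kakImplementerData_junction_swap_of_isEmpty_right [Subsingleton S] [IsEmpty Q] :
    KAKImplementerData (γ𝕎[P, Q, R, S]) (κ P Q R S)
      (fun t : ℝ => (((1 : UForm P Q), (hypV r₀ s₀ t : UForm R S)) : Ginf P Q R S))
      (fun k : DPK P Q R S => unitaryOpPi (dualPairι k))
      (fun t : ℝ => (unitaryOpPi (frameW P Q r₀ s₀)⁻¹).comp
        ((leviS (planeDilW P Q r₀ s₀ t)).comp (unitaryOpPi (frameW P Q r₀ s₀)))) :=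
  kakImplementerData_junction_swap P Q r₀ s₀ UForm.kV_surjective_of_isEmpty_right

/-- The case `P` empty (`V` negative definite at the place). [cite: Folland1989, Prop. (4.39); Knapp2002, Thm 7.39] -/
theorem kakImplementerData_junction_swap_of_isEmpty_left [Subsingleton S] [IsEmpty P] :
    KAKImplementerData (γ𝕎[P, Q, R, S]) (κ P Q R S)
      (fun t : ℝ => (((1 : UForm P Q), (hypV r₀ s₀ t : UForm R S)) : Ginf P Q R S))
      (fun k : DPK P Q R S => unitaryOpPi (dualPairι k))
      (fun t : ℝ => (unitaryOpPi (frameW P Q r₀ s₀)⁻¹).comp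
        ((leviS (planeDilW P Q r₀ s₀ t)).comp (unitaryOpPi (frameW P Q r₀ s₀)))) :=
  kakImplementerData_junction_swap P Q r₀ s₀ UForm.kV_surjective_of_isEmpty_left

end SecondFactor

end RealDualPair

end Literature.RepresentationTheory.KonnoKonno2007

end
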